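/-
Copyright (c) 2026 the pub-hodgecm-mathlib formalisation cell (harness21).  Prover seat hodgecm-mathlib-K2E3-p04 (g3), Track B ∕ K2-LIT
(build stream 29), h413 = `stmt-HodgeConjecture-24833`, line `K2_E3_EllipticInputs`, unit U4 «Keys» — road I («Keys' own road»: the rank-one intertwining
integral), brick I-3k «MACDONALD'S FORMULA AND THE JUNCTION AT EVERY INERT PLACE, DYADIC INCLUDED».  2026-09-04.
-/
import Summits.HodgeConjecture.HodgeConjecture.Theorems.K2E3SphericalReducibilityJunction      -- ★ p856463 (this base, g2): the junction at `v ∤ 2`; brings ★ p856339 Macdonald, ★ Factorization, ★ IndexInert, ★ I-2a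
import Summits.HodgeConjecture.HodgeConjecture.Theorems.K2E3SphericalCFunctionOrganCurrency    -- ★ p856667 (this base, g2): organ currency; brings ★ p856288 UnramifiedHypotheses
import Summits.HodgeConjecture.HodgeConjecture.Theorems.K2E3HeightBallIndexViaCentre          -- ★ p856585 (this base, g2): `[B_q : B₁] = q_F` at every inert place GIVEN a trace-one `z₀`
import Summits.HodgeConjecture.HodgeConjecture.Theorems.K2E3TraceOneAtUnramifiedInertPlace    -- ★ p856746 (this base, g3): the trace-one `z₀` EXISTS at every unramified non-split place
import HarnessLib

/-!
# h413 ∕ Track B «K2-LIT», unit U4 «Keys», road I brick I-3k: MACDONALD'S FORMULA FOR THE `c`-FUNCTION OF `U(Φ₃)(L⁺_v)` AND THE REDUCIBILITY JUNCTION AT EVERY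
# INERT PLACE OF `L⁺` — THE HYPOTHESIS `|2|_w = 1` OF ★ p856339 ∕ ★ p856667 ∕ ★ p856463 REMOVED   [Rogawski1990 §4.5; Casselman1995 §6.4; Keys1984 §4, §7]

Cell `pub/hodgecm-mathlib`, crux H413 = `stmt-HodgeConjecture-24833` (lane `--supports … --as helper`), route HCCMUnconditional; dealer K2E3-plan (g2) 02:16Z (2) («DEFAULT (a)
«=»»).  THEOREMS ONLY (0 def ∕ 0 instance ∕ 0 notation ∕ 0 sorry); ★-only imports.  U4-f `sig_K2E3KeysThmTwoContracting` quantifies over EVERY non-split place `v` of `L⁺`; the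
road-I chain of this base (★ p855911 → p856066 → p856216 → p856339 → p856463) reached Macdonald's closed form and the junction «`i_G(χ)` reducible ⟺ `(B f'_K)(1) = 0`» at the
inert places with `v ∤ 2` only, because the index `[B_q : B₁] = q_F` of the height balls was computed through the Heisenberg chart, a product set only when `|½|_w = 1`.
★ p856585 re-computed the index through the CENTRE of `N` (a sheared product) at every inert place given an element `z₀ ∈ 𝒪_w` of trace `1`, and ★ p856746 supplies that
element at every unramified non-split place (`b = c(a)∕(c a − a)` for a global integer `a` moved by `c` modulo `𝔓_w`).  This file threads the two through the chain:

* §1 **`measure_heightBall_inv_eq_mul_inert`** ∕ **`measureReal_heightBall_inv_eq_mul_inert`** — `μ{‖u₀₂‖ ≤ ‖ϖ‖⁻¹} = q_F · μ{‖u₀₂‖ ≤ 1}` for every Haar `μ` on `N(L⁺_v)` at EVERY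
  inert place (`v` non-split, unramified in `L`; no condition on the residue characteristic).
* §2 **`integral_cellFun_eq_macdonald_inert`** — `∫_N f(w₀u) dμ = μ(B₁)·(1 + z∕q_F)(1 − z∕q_F²)(1 − z²)⁻¹·f(1)` for a `K_v`-fixed `f ∈ i_G(χ₁, χ₂)`, `χ₁` unramified with
  `|χ₁| = ‖·‖^s`, `s > 0`, `z = χ₁(ϖ)` — Macdonald [Rogawski1990 §4.5: root system `{±a, ±2a}`, `q_a = q_F²`, `q_{2a} = q_F`], now at every inert place.
* §3 **`exists_intertwiningIntegral_sphericalVector_eq_macdonald_smul`** — `J(w,χ) f_K = (μ(B₁)·(1 + z∕q_F)(1 − z∕q_F²)∕(1 − z²)·f_K(1)) • f'_K` (docked on ★ I-2a).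
* §4 **`exists_intertwiningIntegral_sphericalVector_eq_macdonald_smul_of_trivial`** — the same in the organ's currency («`χ` trivial on `T ∩ K_v`» + «contracting»).
* §5 **`reducible_iff_forall_counterIntertwiner_eval_eq_zero_inert`** — THE JUNCTION at every inert place: for regular unramified contracting `χ`,
  `i_G(χ)` reducible ⟺ `(B f'_K)(1) = 0` for every `G`-map `B : i(wχ) → i(χ)` (`c_w(χ) ≠ 0` on `|z| < 1`).
Statements = those of ★ p856585 §4 ∕ ★ p856339 §2–§3 ∕ ★ p856667 §3 ∕ ★ p856463 (inert) with the binder `(h2w : Valued.v (2 : w.1.adicCompletion L) = 1)` (resp. `z₀ hz₀ hz₀1`)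
DELETED and nothing else changed; proofs = theirs with the index input re-routed through §1.  What remains place-wise for U4-f on the unramified line after this file: the
junction NUMBER `(B f'_K)(1)` (Road II, Iwahori line) at dyadic inert places, and the WILDLY RAMIFIED places (`v ∣ 2`, `e = 2`: `[B_q : B₁]` depends on the different; REPORT
`K2/K2E3-p04/g2/REPORT-DyadicIndex.K2E3-p04-g2.md`); the tame-ramified places are ★ p856339 §4 ∕ ★ p856463 (ramified).

HONEST LABEL.  HC_CM is proved only modulo the 7 printed citations (2 remaining named inputs: hLiu418 = `stmt-HodgeConjecture-24832`, h413 = `stmt-HodgeConjecture-24833`) until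
rung 0 closes; count-neutral (road I helper toward U4-f).

## References
* [Rogawski1990] J. D. Rogawski, *Automorphic Representations of Unitary Groups in Three Variables*, Ann. of Math. Stud. 123 (1990), §4.5 p. 45 (Macdonald's formula for the
  quasi-split unramified `U(3)`), §1.10 p. 9, §12.2 p. 173 (reducibility points).
* [Casselman1995] W. Casselman, *Introduction to the theory of admissible representations of `p`-adic reductive groups* (1995), §6.4 pp. 62–64 (the `c`-function), Thm. 6.6.2 p. 66.
* [Keys1984] D. Keys, *Principal series representations of special unitary groups over local fields*, Compositio Math. 51 (1984), §4 (spherical∕Iwahori computations), §7 Thm (2).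
* [Serre1979] J.-P. Serre, *Local Fields*, GTM 67 (1979), Ch. V §2 Prop. 3 (trace onto iff unramified).
* [CartierCorvallis1979] P. Cartier, *Representations of `p`-adic groups: a survey*, Proc. Symp. Pure Math. 33 (1979), §IV.1 (spherical vectors), §3.4.
-/

set_option autoImplicit false
-- the mandated namespace repeats the single-problem summit's segment (`HodgeConjecture.HodgeConjecture`)
set_option linter.dupNamespace false

noncomputable section

open NumberField IsDedekindDomain MeasureTheory
open scoped Matrix NNReal ENNReal

open Literature.NumberTheory Literature.NumberTheory.Automorphic Literature.NumberTheory.Automorphic.UnitaryGroup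
open Literature.NumberTheory.GaloisRepresentations Literature.NumberTheory.GaloisRepresentations.IsNonarchimedeanLocalField

namespace Summit.HodgeConjecture.HodgeConjecture.Cruxes.H413.K2E3SphericalCFunctionMacdonaldInertDyadic

variable (L : Type) [Field L] [NumberField L] [IsCMField L] (v : HeightOneSpectrum (𝓞 ↥(maximalRealSubfield L)))

/-! ## §1 The index `[B_q : B₁] = q_F` at EVERY inert place (dyadic included) -/

set_option synthInstance.maxHeartbeats 400000 in
set_option maxHeartbeats 4000000 in
-- the matrix-group carrier of `N(L⁺_v)` + the Heisenberg chart measure (class of ★ `K2E3HeightBallIndexViaCentre.measure_heightBall_inv_eq_mul_of_traceOne`)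
/-- **THE INDEX `[B_q : B₁] = q_F` AT EVERY INERT PLACE — NO CONDITION ON THE RESIDUE CHARACTERISTIC.**  `v` non-split, UNRAMIFIED in `L`, `q_F = N𝔭_v`, `ϖ` a uniformiser unit
(`‖ϖ‖ = q_F⁻²`): for EVERY Haar measure `μ` of `N(L⁺_v)`, **`μ {u : ‖u₀₂‖ ≤ ‖ϖ‖⁻¹} = q_F · μ {u : ‖u₀₂‖ ≤ 1}`** — ★ p856585 `measure_heightBall_inv_eq_mul_of_traceOne` (chart-shear through the
centre of `N`) with its trace-one element supplied by ★ `K2E3TraceOneAtUnramifiedInertPlace.exists_traceOne_localRing_at` (`tr : 𝒪_{L_w} → 𝒪_{L⁺_v}` is onto at an unramified place).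
At `v ∤ 2` this is ★ p856166; the new content is the dyadic inert places. [cite: Rogawski1990, §1.10 p. 9; §4.5 p. 45] [cite: Casselman1995, §6.4 p. 63] [cite: Serre1979, Ch. V §2 Prop. 3] -/
theorem measure_heightBall_inv_eq_mul_inert (hns : ∀ w : PlacesOver L v, IsCMField.complexConj L • w.1 = w.1) (w : PlacesOver L v) (hunr : Algebra.IsUnramifiedIn (𝓞 L) v.asIdeal)
    (ϖ : (LocalRing L v)ˣ) (hϖ : ∀ w' : PlacesOver L v, Valued.v ((ϖ : LocalRing L v) w') = WithZero.exp (-1 : ℤ))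
    [MeasurableSpace ↥(cmBorelTriple L 3 v).N] [BorelSpace ↥(cmBorelTriple L 3 v).N] (μ : Measure ↥(cmBorelTriple L 3 v).N) [μ.IsHaarMeasure] :
    μ {u : ↥(cmBorelTriple L 3 v).N | (((∏ w' : PlacesOver L v, normAbs (w'.1.adicCompletion L) ((((((u : ↥(unitaryGroupOfForm (conjLocal L (IsCMField.complexConj L) v) (cmLocalForm L 3 v)))) : GL (Fin 3) (LocalRing L v)) : Matrix (Fin 3) (Fin 3) (LocalRing L v)) 0 2) w')) : ℝ≥0) : ℝ) ≤ ((unitModulusChar (LocalRing L v) ϖ : ℝ≥0) : ℝ)⁻¹} =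
      ((Ideal.absNorm v.asIdeal : ℝ≥0) : ℝ≥0∞) * μ {u : ↥(cmBorelTriple L 3 v).N | (((∏ w' : PlacesOver L v, normAbs (w'.1.adicCompletion L) ((((((u : ↥(unitaryGroupOfForm (conjLocal L (IsCMField.complexConj L) v) (cmLocalForm L 3 v)))) : GL (Fin 3) (LocalRing L v)) : Matrix (Fin 3) (Fin 3) (LocalRing L v)) 0 2) w')) : ℝ≥0) : ℝ) ≤ 1} := by
  obtain ⟨z₀, hz₀, hz₀1⟩ := K2E3TraceOneAtUnramifiedInertPlace.exists_traceOne_localRing_at L v w (hns w) hunr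
  exact K2E3HeightBallIndexViaCentre.measure_heightBall_inv_eq_mul_of_traceOne L v w (hns w) hunr z₀ hz₀ hz₀1 ϖ hϖ μ

set_option synthInstance.maxHeartbeats 400000 in
set_option maxHeartbeats 4000000 in
-- the matrix-group carrier of `N(L⁺_v)` (class of ★ `K2E3HeightBallIndexViaCentre.measureReal_heightBall_inv_eq_mul_of_traceOne`)
/-- **`μ.real {‖u₀₂‖ ≤ ‖ϖ‖⁻¹} = q_F · μ.real {‖u₀₂‖ ≤ 1}` at EVERY inert place** — real-valued form (the currency of ★ `K2E3SphericalCFunctionFactorization.integral_cellFun_eq_factoredForm`).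
[cite: Rogawski1990, §4.5 p. 45] [cite: Casselman1995, §6.4 p. 63] -/
theorem measureReal_heightBall_inv_eq_mul_inert (hns : ∀ w : PlacesOver L v, IsCMField.complexConj L • w.1 = w.1) (w : PlacesOver L v) (hunr : Algebra.IsUnramifiedIn (𝓞 L) v.asIdeal)
    (ϖ : (LocalRing L v)ˣ) (hϖ : ∀ w' : PlacesOver L v, Valued.v ((ϖ : LocalRing L v) w') = WithZero.exp (-1 : ℤ))
    [MeasurableSpace ↥(cmBorelTriple L 3 v).N] [BorelSpace ↥(cmBorelTriple L 3 v).N] (μ : Measure ↥(cmBorelTriple L 3 v).N) [μ.IsHaarMeasure] :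
    μ.real {u : ↥(cmBorelTriple L 3 v).N | (((∏ w' : PlacesOver L v, normAbs (w'.1.adicCompletion L) ((((((u : ↥(unitaryGroupOfForm (conjLocal L (IsCMField.complexConj L) v) (cmLocalForm L 3 v)))) : GL (Fin 3) (LocalRing L v)) : Matrix (Fin 3) (Fin 3) (LocalRing L v)) 0 2) w')) : ℝ≥0) : ℝ) ≤ ((unitModulusChar (LocalRing L v) ϖ : ℝ≥0) : ℝ)⁻¹} =
      (Ideal.absNorm v.asIdeal : ℝ) * μ.real {u : ↥(cmBorelTriple L 3 v).N | (((∏ w' : PlacesOver L v, normAbs (w'.1.adicCompletion L) ((((((u : ↥(unitaryGroupOfForm (conjLocal L (IsCMField.complexConj L) v) (cmLocalForm L 3 v)))) : GL (Fin 3) (LocalRing L v)) : Matrix (Fin 3) (Fin 3) (LocalRing L v)) 0 2) w')) : ℝ≥0) : ℝ) ≤ 1} := by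
  obtain ⟨z₀, hz₀, hz₀1⟩ := K2E3TraceOneAtUnramifiedInertPlace.exists_traceOne_localRing_at L v w (hns w) hunr
  exact K2E3HeightBallIndexViaCentre.measureReal_heightBall_inv_eq_mul_of_traceOne L v w (hns w) hunr z₀ hz₀ hz₀1 ϖ hϖ μ

/-! ## §2 Macdonald's formula for `∫_N f(w₀ u) dμ` at every inert place -/

set_option synthInstance.maxHeartbeats 400000 in
set_option maxHeartbeats 8000000 in
-- statement∕proof over the `SmoothInd` carrier of ★ `cmPrincipalSeries` (class of ★ `K2E3SphericalCFunctionMacdonald.integral_cellFun_eq_macdonald_inert`)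
/-- **MACDONALD'S FORMULA AT EVERY INERT PLACE, DYADIC INCLUDED.**  `v` non-split, UNRAMIFIED in `L` (ANY residue characteristic; `q_F = N𝔭_v`), `w₀` of matrix `Φ₃`, `μ` a Haar measure of `N(L⁺_v)`,
`ϖ` a uniformiser unit, `χ₂` continuous with `χ₂(−1) = 1`, `χ₁` UNRAMIFIED with `|χ₁(x)| = ‖x‖^s`, `s > 0`, `z = χ₁(ϖ)`, `f` a `K_v`-fixed vector of ★ `cmPrincipalSeries L 3 v (χ₁, χ₂)`.  Then
**`∫_N f(w₀ u) dμ = μ(B₁) · (1 + z∕q_F)(1 − z∕q_F²)(1 − z²)⁻¹ · f(1)`**, `B₁ = {‖u₀₂‖ ≤ 1} = N(𝒪_v)` — ★ `integral_cellFun_eq_factoredForm` + §1 + ★ `unitModulusChar_uniformizer_eq_inert`; the statement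
of ★ p856339 §2 with its hypothesis `|2|_w = 1` REMOVED. [cite: Rogawski1990, §4.5 p. 45] [cite: Casselman1995, §6.4 pp. 62–64] [cite: Keys1984, §4] -/
theorem integral_cellFun_eq_macdonald_inert (hns : ∀ w : PlacesOver L v, IsCMField.complexConj L • w.1 = w.1) (w : PlacesOver L v)
    (hunrL : Algebra.IsUnramifiedIn (𝓞 L) v.asIdeal)
    (χ₁ : (LocalRing L v)ˣ →* ℂˣ) (χ₂ : ↥(normOneUnits (conjLocal L (IsCMField.complexConj L) v)) →* ℂˣ)
    (h₂ : Continuous fun x => ((χ₂ x : ℂˣ) : ℂ)) (hχ₂ : χ₂ ⟨-1, F0P3cStCharTSBigCellFactorisation.neg_one_mem_normOneUnits (conjLocal L (IsCMField.complexConj L) v)⟩ = 1)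
    (hunr : ∀ u ∈ (Submonoid.pi Set.univ (fun w : PlacesOver L v => (w.1.adicCompletionIntegers L).toSubring.toSubmonoid)).units, χ₁ u = 1) {s : ℝ} (hs : 0 < s)
    (hχ₁ : ∀ x : (LocalRing L v)ˣ, ‖((χ₁ x : ℂˣ) : ℂ)‖ = ((unitModulusChar (LocalRing L v) x : ℝ≥0) : ℝ) ^ s)
    (ϖ : (LocalRing L v)ˣ) (hϖ : ∀ w : PlacesOver L v, Valued.v ((ϖ : LocalRing L v) w) = WithZero.exp (-1 : ℤ))
    (w₀ : ↥(unitaryGroupOfForm (conjLocal L (IsCMField.complexConj L) v) (cmLocalForm L 3 v))) (hw₀ : Units.val (w₀ : GL (Fin 3) (LocalRing L v)) = cmLocalForm L 3 v)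
    [MeasurableSpace ↥(cmBorelTriple L 3 v).N] [BorelSpace ↥(cmBorelTriple L 3 v).N] (μ : Measure ↥(cmBorelTriple L 3 v).N) [μ.IsHaarMeasure]
    (f : haveI := locallyCompactSpace_cmBorelU L 3 v
      Representation.SmoothInd (cmBorelTriple L 3 v).P (Representation.twist (((Representation.trivial ℂ ↥(torusU (conjLocal L (IsCMField.complexConj L) v) (cmLocalForm L 3 v)) ℂ).twist
        (cmTorusCharPair L v χ₁ χ₂)).comp (cmBorelTriple L 3 v).proj) (rootDeltaChar (cmBorelTriple L 3 v).P)))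
    (hf : haveI := locallyCompactSpace_cmBorelU L 3 v
      f ∈ (Representation.smoothIndRep (cmBorelTriple L 3 v).P _).fixedPoints (cmLocalIntegralLevel L 3 (Matrix.of fun i j : Fin 3 => if i.val + j.val + 1 = 3 then (1 : L) else 0) v)) :
    ∫ u : ↥(cmBorelTriple L 3 v).N, f.toFun (w₀ * (u : ↥(unitaryGroupOfForm (conjLocal L (IsCMField.complexConj L) v) (cmLocalForm L 3 v)))) ∂μ =
      (μ.real {u : ↥(cmBorelTriple L 3 v).N | (((∏ w' : PlacesOver L v, normAbs (w'.1.adicCompletion L) ((((((u : ↥(unitaryGroupOfForm (conjLocal L (IsCMField.complexConj L) v) (cmLocalForm L 3 v)))) : GL (Fin 3) (LocalRing L v)) : Matrix (Fin 3) (Fin 3) (LocalRing L v)) 0 2) w')) : ℝ≥0) : ℝ) ≤ 1} : ℂ) * ((1 + ((χ₁ ϖ : ℂˣ) : ℂ) / ((Ideal.absNorm v.asIdeal : ℕ) : ℂ)) * (1 - ((χ₁ ϖ : ℂˣ) : ℂ) / ((Ideal.absNorm v.asIdeal : ℕ) : ℂ) ^ 2) * (1 - ((χ₁ ϖ : ℂˣ)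 : ℂ) ^ 2)⁻¹) * f.toFun 1 := by
  have hw := hns w
  have hq0 : ((Ideal.absNorm v.asIdeal : ℕ) : ℂ) ≠ 0 := by exact_mod_cast fun h => v.ne_bot (Ideal.absNorm_eq_zero_iff.1 h)
  have ha : ((unitModulusChar (LocalRing L v) ϖ : ℝ≥0) : ℝ) = ((((Ideal.absNorm v.asIdeal : ℕ) : ℝ)) ^ 2)⁻¹ := by
    rw [K2E3SphericalCFunctionMacdonald.unitModulusChar_uniformizer_eq_inert L v w hw hunrL ϖ hϖ, NNReal.coe_inv, NNReal.coe_pow, NNReal.coe_natCast]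
  rw [K2E3SphericalCFunctionFactorization.integral_cellFun_eq_factoredForm L v hns χ₁ χ₂ h₂ hχ₂ hunr hs hχ₁ ϖ hϖ w₀ hw₀ μ f hf,
    measureReal_heightBall_inv_eq_mul_inert L v hns w hunrL ϖ hϖ μ, ha]
  set M₀ : ℝ := μ.real {u : ↥(cmBorelTriple L 3 v).N | (((∏ w' : PlacesOver L v, normAbs (w'.1.adicCompletion L) ((((((u : ↥(unitaryGroupOfForm (conjLocal L (IsCMField.complexConj L) v) (cmLocalForm L 3 v)))) : GL (Fin 3) (LocalRing L v)) : Matrix (Fin 3) (Fin 3) (LocalRing L v)) 0 2) w')) : ℝ≥0) : ℝ) ≤ 1} with hM₀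
  push_cast
  field_simp

/-! ## §3 Harish-Chandra's `c`-function in Macdonald's form at every inert place -/

set_option synthInstance.maxHeartbeats 400000 in
set_option maxHeartbeats 8000000 in
-- statement∕proof over two `SmoothInd` carriers of ★ `cmPrincipalSeries` (class of ★ `K2E3SphericalCFunctionMacdonald.exists_intertwiningIntegral_sphericalVector_eq_macdonald_smul`)
/-- **HARISH-CHANDRA'S `c`-FUNCTION OF `U(Φ₃)(L⁺_v)` IN MACDONALD'S FORM AT EVERY INERT PLACE, DYADIC INCLUDED** (docked on ★ I-2a).  `v` non-split, UNRAMIFIED in `L`, `q_F = N𝔭_v`; `w₀` of matrix `Φ₃`,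
`μ` a Haar measure of `N(L⁺_v)`, `ϖ` a uniformiser unit; `χ₁, χ₂` continuous, `χ₂(−1) = 1`, `χ₁` UNRAMIFIED with `|χ₁| = ‖·‖^s`, `s > 0`, `z = χ₁(ϖ)`; `f_K ∈ i_G(χ)^{K_v}`, `f'_K ∈ i_G(wχ)^{K_v}`,
`f'_K(1) = 1`.  Then the intertwining integral `J ≠ 0` of ★ RUNG 3 satisfies **`J f_K = (μ(B₁)·(1 + z∕q_F)(1 − z∕q_F²)(1 − z²)⁻¹ · f_K(1)) • f'_K`** — ★ p856339 §3 without `|2|_w = 1`.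
[cite: Rogawski1990, §4.5 p. 45; §12.2 p. 173] [cite: Casselman1995, §6.4 pp. 62–64] [cite: Keys1984, §4, §7 Thm (2)] -/
theorem exists_intertwiningIntegral_sphericalVector_eq_macdonald_smul (hns : ∀ w : PlacesOver L v, IsCMField.complexConj L • w.1 = w.1) (w : PlacesOver L v)
    (hunrL : Algebra.IsUnramifiedIn (𝓞 L) v.asIdeal)
    (χ₁ : (LocalRing L v)ˣ →* ℂˣ) (χ₂ : ↥(normOneUnits (conjLocal L (IsCMField.complexConj L) v)) →* ℂˣ)
    (h₁ : Continuous fun x => ((χ₁ x : ℂˣ) : ℂ)) (h₂ : Continuous fun x => ((χ₂ x : ℂˣ) : ℂ)) (hχ₂ : χ₂ ⟨-1, F0P3cStCharTSBigCellFactorisation.neg_one_mem_normOneUnits (conjLocal L (IsCMField.complexConj L) v)⟩ = 1)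
    (hunr : ∀ u ∈ (Submonoid.pi Set.univ (fun w : PlacesOver L v => (w.1.adicCompletionIntegers L).toSubring.toSubmonoid)).units, χ₁ u = 1) {s : ℝ} (hs : 0 < s)
    (hχ₁ : ∀ x : (LocalRing L v)ˣ, ‖((χ₁ x : ℂˣ) : ℂ)‖ = ((unitModulusChar (LocalRing L v) x : ℝ≥0) : ℝ) ^ s)
    (ϖ : (LocalRing L v)ˣ) (hϖ : ∀ w : PlacesOver L v, Valued.v ((ϖ : LocalRing L v) w) = WithZero.exp (-1 : ℤ))
    (w₀ : ↥(unitaryGroupOfForm (conjLocal L (IsCMField.complexConj L) v) (cmLocalForm L 3 v))) (hw₀ : Units.val (w₀ : GL (Fin 3) (LocalRing L v)) = cmLocalForm L 3 v)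
    [MeasurableSpace ↥(cmBorelTriple L 3 v).N] [BorelSpace ↥(cmBorelTriple L 3 v).N] (μ : Measure ↥(cmBorelTriple L 3 v).N) [μ.IsHaarMeasure]
    (fK : haveI := locallyCompactSpace_cmBorelU L 3 v
      Representation.SmoothInd (cmBorelTriple L 3 v).P (Representation.twist (((Representation.trivial ℂ ↥(torusU (conjLocal L (IsCMField.complexConj L) v) (cmLocalForm L 3 v)) ℂ).twist
        (cmTorusCharPair L v χ₁ χ₂)).comp (cmBorelTriple L 3 v).proj) (rootDeltaChar (cmBorelTriple L 3 v).P)))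
    (hfK : haveI := locallyCompactSpace_cmBorelU L 3 v
      fK ∈ (Representation.smoothIndRep (cmBorelTriple L 3 v).P _).fixedPoints (cmLocalIntegralLevel L 3 (Matrix.of fun i j : Fin 3 => if i.val + j.val + 1 = 3 then (1 : L) else 0) v))
    (fK' : haveI := locallyCompactSpace_cmBorelU L 3 v
      Representation.SmoothInd (cmBorelTriple L 3 v).P (Representation.twist (((Representation.trivial ℂ ↥(torusU (conjLocal L (IsCMField.complexConj L) v) (cmLocalForm L 3 v)) ℂ).twist
        (cmTorusCharPair L v (conjInvChar (conjLocal L (IsCMField.complexConj L) v) χ₁) χ₂)).comp (cmBorelTriple L 3 v).proj) (rootDeltaChar (cmBorelTriple L 3 v).P)))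
    (hfK' : haveI := locallyCompactSpace_cmBorelU L 3 v
      fK' ∈ (Representation.smoothIndRep (cmBorelTriple L 3 v).P _).fixedPoints (cmLocalIntegralLevel L 3 (Matrix.of fun i j : Fin 3 => if i.val + j.val + 1 = 3 then (1 : L) else 0) v))
    (h1 : fK'.toFun 1 = 1) :
    ∃ J : (cmPrincipalSeries L 3 v (cmTorusCharPair L v χ₁ χ₂)).IntertwiningMap (cmPrincipalSeries L 3 v (cmTorusCharPair L v (conjInvChar (conjLocal L (IsCMField.complexConj L) v) χ₁) χ₂)),
      J ≠ 0 ∧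
      (∀ (f : haveI := locallyCompactSpace_cmBorelU L 3 v
      Representation.SmoothInd (cmBorelTriple L 3 v).P (Representation.twist (((Representation.trivial ℂ ↥(torusU (conjLocal L (IsCMField.complexConj L) v) (cmLocalForm L 3 v)) ℂ).twist
        (cmTorusCharPair L v χ₁ χ₂)).comp (cmBorelTriple L 3 v).proj) (rootDeltaChar (cmBorelTriple L 3 v).P)))
        (g : ↥(unitaryGroupOfForm (conjLocal L (IsCMField.complexConj L) v) (cmLocalForm L 3 v))),
        (J f).toFun g = ∫ n : ↥(cmBorelTriple L 3 v).N, f.toFun (w₀ * (n : ↥(unitaryGroupOfForm (conjLocal L (IsCMField.complexConj L) v) (cmLocalForm L 3 v))) * g) ∂μ) ∧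
      J fK = ((μ.real {u : ↥(cmBorelTriple L 3 v).N | (((∏ w' : PlacesOver L v, normAbs (w'.1.adicCompletion L) ((((((u : ↥(unitaryGroupOfForm (conjLocal L (IsCMField.complexConj L) v) (cmLocalForm L 3 v)))) : GL (Fin 3) (LocalRing L v)) : Matrix (Fin 3) (Fin 3) (LocalRing L v)) 0 2) w')) : ℝ≥0) : ℝ) ≤ 1} : ℂ) * ((1 + ((χ₁ ϖ : ℂˣ) : ℂ) / ((Ideal.absNorm v.asIdeal : ℕ) : ℂ)) * (1 - ((χ₁ ϖ : ℂˣ) : ℂ) / ((Ideal.absNorm v.asIdeal : ℕ) : ℂ) ^ 2) * (1 - ((χ₁ ϖ : ℂˣ) : ℂ) ^ 2)⁻¹) * fK.toFun 1) • fK' := by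
  obtain ⟨J, hJ, hJint, hJK⟩ := K2E3IntertwiningIntegralSphericalLine.exists_intertwiningIntegral_sphericalVector_eq_smul L v hns χ₁ χ₂ h₁ h₂ hs hχ₁ w₀ hw₀ μ
    fK hfK fK' hfK' h1
  refine ⟨J, hJ, hJint, ?_⟩
  rw [hJK, integral_cellFun_eq_macdonald_inert L v hns w hunrL χ₁ χ₂ h₂ hχ₂ hunr hs hχ₁ ϖ hϖ w₀ hw₀ μ fK hfK]

/-! ## §4 The organ's currency: `χ` trivial on `T ∩ K_v` and contracting -/

set_option synthInstance.maxHeartbeats 400000 in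
set_option maxHeartbeats 8000000 in
-- statement∕proof over two `SmoothInd` carriers of ★ `cmPrincipalSeries` (class of ★ `K2E3SphericalCFunctionOrganCurrency.exists_intertwiningIntegral_sphericalVector_eq_macdonald_smul_of_trivial`)
/-- **HARISH-CHANDRA'S `c`-FUNCTION OF A `K_v`-SPHERICAL CONTRACTING `i_G(χ₁, χ₂)` AT EVERY INERT PLACE, organ currency** — ★ p856667 §3 without `|2|_w = 1`: `v` non-split, UNRAMIFIED in `L`
(any residue characteristic), `χ = (χ₁, χ₂)` continuous, TRIVIAL ON `T ∩ K_v`, `χ₁` CONTRACTING; `f_K ∈ i(χ)^{K_v}`, `f'_K ∈ i(wχ)^{K_v}`, `f'_K(1) = 1`; then `J ≠ 0` with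
**`J f_K = (μ(B₁)·(1 + z∕q_F)(1 − z∕q_F²)(1 − z²)⁻¹ · f_K(1)) • f'_K`** (working hypotheses (H1)(H2)(H3) ★ p856288, then §3).
[cite: Rogawski1990, §4.5 p. 45; §12.2 p. 173] [cite: Casselman1995, §6.4 pp. 62–64] [cite: Keys1984, §4; §7 Thm (2)] [cite: CartierCorvallis1979, §IV.1] -/
theorem exists_intertwiningIntegral_sphericalVector_eq_macdonald_smul_of_trivial (hns : ∀ w : PlacesOver L v, IsCMField.complexConj L • w.1 = w.1) (w : PlacesOver L v)
    (hunrL : Algebra.IsUnramifiedIn (𝓞 L) v.asIdeal)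
    (χ₁ : (LocalRing L v)ˣ →* ℂˣ) (χ₂ : ↥(normOneUnits (conjLocal L (IsCMField.complexConj L) v)) →* ℂˣ)
    (h₁ : Continuous fun x => ((χ₁ x : ℂˣ) : ℂ)) (h₂ : Continuous fun x => ((χ₂ x : ℂˣ) : ℂ))
    (hχK : ∀ t : ↥(torusU (conjLocal L (IsCMField.complexConj L) v) (cmLocalForm L 3 v)), (t : ↥(unitaryGroupOfForm (conjLocal L (IsCMField.complexConj L) v) (cmLocalForm L 3 v))) ∈ cmLocalIntegralLevel L 3 (Matrix.of fun i j : Fin 3 => if i.val + j.val + 1 = 3 then (1 : L) else 0) v → cmTorusCharPair L v χ₁ χ₂ t = 1)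
    (hcontr : ∀ x : (LocalRing L v)ˣ, unitModulusChar (LocalRing L v) x < 1 → ‖((χ₁ x : ℂˣ) : ℂ)‖ < 1)
    (ϖ : (LocalRing L v)ˣ) (hϖ : ∀ w : PlacesOver L v, Valued.v ((ϖ : LocalRing L v) w) = WithZero.exp (-1 : ℤ))
    (w₀ : ↥(unitaryGroupOfForm (conjLocal L (IsCMField.complexConj L) v) (cmLocalForm L 3 v))) (hw₀ : Units.val (w₀ : GL (Fin 3) (LocalRing L v)) = cmLocalForm L 3 v)
    [MeasurableSpace ↥(cmBorelTriple L 3 v).N] [BorelSpace ↥(cmBorelTriple L 3 v).N] (μ : Measure ↥(cmBorelTriple L 3 v).N) [μ.IsHaarMeasure]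
    (fK : haveI := locallyCompactSpace_cmBorelU L 3 v
      Representation.SmoothInd (cmBorelTriple L 3 v).P (Representation.twist (((Representation.trivial ℂ ↥(torusU (conjLocal L (IsCMField.complexConj L) v) (cmLocalForm L 3 v)) ℂ).twist
        (cmTorusCharPair L v χ₁ χ₂)).comp (cmBorelTriple L 3 v).proj) (rootDeltaChar (cmBorelTriple L 3 v).P)))
    (hfK : haveI := locallyCompactSpace_cmBorelU L 3 v
      fK ∈ (Representation.smoothIndRep (cmBorelTriple L 3 v).P _).fixedPoints (cmLocalIntegralLevel L 3 (Matrix.of fun i j : Fin 3 => if i.val + j.val + 1 = 3 then (1 : L) else 0) v))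
    (fK' : haveI := locallyCompactSpace_cmBorelU L 3 v
      Representation.SmoothInd (cmBorelTriple L 3 v).P (Representation.twist (((Representation.trivial ℂ ↥(torusU (conjLocal L (IsCMField.complexConj L) v) (cmLocalForm L 3 v)) ℂ).twist
        (cmTorusCharPair L v (conjInvChar (conjLocal L (IsCMField.complexConj L) v) χ₁) χ₂)).comp (cmBorelTriple L 3 v).proj) (rootDeltaChar (cmBorelTriple L 3 v).P)))
    (hfK' : haveI := locallyCompactSpace_cmBorelU L 3 v
      fK' ∈ (Representation.smoothIndRep (cmBorelTriple L 3 v).P _).fixedPoints (cmLocalIntegralLevel L 3 (Matrix.of fun i j : Fin 3 => if i.val + j.val + 1 = 3 then (1 : L) else 0) v))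
    (hK'1 : fK'.toFun 1 = 1) :
    ∃ J : (cmPrincipalSeries L 3 v (cmTorusCharPair L v χ₁ χ₂)).IntertwiningMap (cmPrincipalSeries L 3 v (cmTorusCharPair L v (conjInvChar (conjLocal L (IsCMField.complexConj L) v) χ₁) χ₂)),
      J ≠ 0 ∧
      (∀ (f : haveI := locallyCompactSpace_cmBorelU L 3 v
      Representation.SmoothInd (cmBorelTriple L 3 v).P (Representation.twist (((Representation.trivial ℂ ↥(torusU (conjLocal L (IsCMField.complexConj L) v) (cmLocalForm L 3 v)) ℂ).twist
        (cmTorusCharPair L v χ₁ χ₂)).comp (cmBorelTriple L 3 v).proj) (rootDeltaChar (cmBorelTriple L 3 v).P)))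
        (g : ↥(unitaryGroupOfForm (conjLocal L (IsCMField.complexConj L) v) (cmLocalForm L 3 v))),
        (J f).toFun g = ∫ n : ↥(cmBorelTriple L 3 v).N, f.toFun (w₀ * (n : ↥(unitaryGroupOfForm (conjLocal L (IsCMField.complexConj L) v) (cmLocalForm L 3 v))) * g) ∂μ) ∧
      J fK = ((μ.real {u : ↥(cmBorelTriple L 3 v).N | (((∏ w' : PlacesOver L v, normAbs (w'.1.adicCompletion L) ((((((u : ↥(unitaryGroupOfForm (conjLocal L (IsCMField.complexConj L) v) (cmLocalForm L 3 v)))) : GL (Fin 3) (LocalRing L v)) : Matrix (Fin 3) (Fin 3) (LocalRing L v)) 0 2) w')) : ℝ≥0) : ℝ) ≤ 1} : ℂ) * ((1 + ((χ₁ ϖ : ℂˣ) : ℂ) / ((Ideal.absNorm v.asIdeal : ℕ) : ℂ)) * (1 - ((χ₁ ϖ : ℂˣ) : ℂ) / ((Ideal.absNorm v.asIdeal : ℕ) : ℂ) ^ 2) * (1 - ((χ₁ ϖ : ℂˣ) : ℂ) ^ 2)⁻¹) * fK.toFun 1) • fK' := by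
  have hunr := K2E3SphericalCFunctionUnramifiedHypotheses.apply_eq_one_of_mem_unitsIntegers_of_trivial L v hns χ₁ χ₂ hχK
  have hχ₂ := K2E3SphericalCFunctionUnramifiedHypotheses.apply_neg_one_eq_one_of_trivial L v hns χ₁ χ₂ hχK
  obtain ⟨s, hs, hχ₁⟩ := K2E3SphericalCFunctionUnramifiedHypotheses.exists_rpow_modulus_of_unramified_of_contracting L v hns χ₁ hunr hcontr
  exact exists_intertwiningIntegral_sphericalVector_eq_macdonald_smul L v hns w hunrL χ₁ χ₂ h₁ h₂ hχ₂ hunr hs hχ₁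
    ϖ hϖ w₀ hw₀ μ fK hfK fK' hfK' hK'1

/-! ## §5 The junction at every inert place: reducible ⟺ the counter-intertwiner kills the spherical vector -/

set_option synthInstance.maxHeartbeats 400000 in
set_option maxHeartbeats 8000000 in
-- statement∕proof over two `SmoothInd` carriers of ★ `cmPrincipalSeries` (class of ★ `K2E3SphericalReducibilityJunction.reducible_iff_forall_counterIntertwiner_eval_eq_zero_inert`)
/-- **THE JUNCTION AT EVERY INERT PLACE, DYADIC INCLUDED** — ★ p856463 (inert) without `|2|_w = 1`.  `v` non-split, unramified in `L`, `w₀` of matrix `Φ₃`, `μ` Haar on `N(L⁺_v)`, `ϖ` a uniformiser unit;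
`χ₁, χ₂` continuous, `χ₂(−1) = 1`, `χ₁ = 1` on `𝒪_vˣ`, `|χ₁| = ‖·‖^s` with `s > 0` (so `χ` is regular and `|z| < 1`, `z = χ₁(ϖ)`); `f_K ∈ i(χ)^{K_v}`, `f'_K ∈ i(wχ)^{K_v}` with
`f_K(1) = f'_K(1) = 1`.  Then **`i_G(χ)` is reducible ⟺ `(B f'_K)(1) = 0` for every `G`-map `B : i(wχ) → i(χ)`** (`A = J(w, χ)` has `(J f_K)(1) = μ(B₁)·(1 + z∕q_F)(1 − z∕q_F²)∕(1 − z²) ≠ 0` by §3,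
★ `measureReal_heightBall_one_pos` and `|z| < 1`; then ★ `reducible_iff_forall_eval_mul_eval_eq_zero`). [cite: Casselman1995, Thm. 6.6.2 p. 66; §6.4] [cite: Keys1984, §7 Thm (2); §3]
[cite: Rogawski1990, §4.5 p. 45; §12.2 p. 173] -/
theorem reducible_iff_forall_counterIntertwiner_eval_eq_zero_inert (hns : ∀ w : PlacesOver L v, IsCMField.complexConj L • w.1 = w.1) (w : PlacesOver L v)
    (hunrL : Algebra.IsUnramifiedIn (𝓞 L) v.asIdeal)
    (χ₁ : (LocalRing L v)ˣ →* ℂˣ) (χ₂ : ↥(normOneUnits (conjLocal L (IsCMField.complexConj L) v)) →* ℂˣ) (h₁ : Continuous fun x => ((χ₁ x : ℂˣ) : ℂ)) (h₂ : Continuous fun x => ((χ₂ x : ℂˣ) : ℂ)) (hχ₂ : χ₂ ⟨-1, F0P3cStCharTSBigCellFactorisation.neg_one_mem_normOneUnits (conjLocal L (IsCMField.complexConj L) v)⟩ = 1)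
    (hunr : ∀ u ∈ (Submonoid.pi Set.univ (fun w : PlacesOver L v => (w.1.adicCompletionIntegers L).toSubring.toSubmonoid)).units, χ₁ u = 1) {s : ℝ} (hs : 0 < s)
    (hχ₁ : ∀ x : (LocalRing L v)ˣ, ‖((χ₁ x : ℂˣ) : ℂ)‖ = ((unitModulusChar (LocalRing L v) x : ℝ≥0) : ℝ) ^ s)
    (ϖ : (LocalRing L v)ˣ) (hϖ : ∀ w : PlacesOver L v, Valued.v ((ϖ : LocalRing L v) w) = WithZero.exp (-1 : ℤ))
    (w₀ : ↥(unitaryGroupOfForm (conjLocal L (IsCMField.complexConj L) v) (cmLocalForm L 3 v))) (hw₀ : Units.val (w₀ : GL (Fin 3) (LocalRing L v)) = cmLocalForm L 3 v)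
    [MeasurableSpace ↥(cmBorelTriple L 3 v).N] [BorelSpace ↥(cmBorelTriple L 3 v).N] (μ : Measure ↥(cmBorelTriple L 3 v).N) [μ.IsHaarMeasure]
    (fK : haveI := locallyCompactSpace_cmBorelU L 3 v
      Representation.SmoothInd (cmBorelTriple L 3 v).P (Representation.twist (((Representation.trivial ℂ ↥(torusU (conjLocal L (IsCMField.complexConj L) v) (cmLocalForm L 3 v)) ℂ).twist
        (cmTorusCharPair L v χ₁ χ₂)).comp (cmBorelTriple L 3 v).proj) (rootDeltaChar (cmBorelTriple L 3 v).P)))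
    (hfK : haveI := locallyCompactSpace_cmBorelU L 3 v
      fK ∈ (Representation.smoothIndRep (cmBorelTriple L 3 v).P _).fixedPoints (cmLocalIntegralLevel L 3 (Matrix.of fun i j : Fin 3 => if i.val + j.val + 1 = 3 then (1 : L) else 0) v)) (hK1 : fK.toFun 1 = 1)
    (fK' : haveI := locallyCompactSpace_cmBorelU L 3 v
      Representation.SmoothInd (cmBorelTriple L 3 v).P (Representation.twist (((Representation.trivial ℂ ↥(torusU (conjLocal L (IsCMField.complexConj L) v) (cmLocalForm L 3 v)) ℂ).twist
        (cmTorusCharPair L v (conjInvChar (conjLocal L (IsCMField.complexConj L) v) χ₁) χ₂)).comp (cmBorelTriple L 3 v).proj) (rootDeltaChar (cmBorelTriple L 3 v).P)))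
    (hfK' : haveI := locallyCompactSpace_cmBorelU L 3 v
      fK' ∈ (Representation.smoothIndRep (cmBorelTriple L 3 v).P _).fixedPoints (cmLocalIntegralLevel L 3 (Matrix.of fun i j : Fin 3 => if i.val + j.val + 1 = 3 then (1 : L) else 0) v)) (hK'1 : fK'.toFun 1 = 1) :
    (∃ N : Subrepresentation (cmPrincipalSeries L 3 v (cmTorusCharPair L v χ₁ χ₂)), N ≠ ⊥ ∧ N ≠ ⊤) ↔
      ∀ (B : (cmPrincipalSeries L 3 v (cmTorusCharPair L v (conjInvChar (conjLocal L (IsCMField.complexConj L) v) χ₁) χ₂)).IntertwiningMap (cmPrincipalSeries L 3 v (cmTorusCharPair L v χ₁ χ₂))), (B fK').toFun 1 = 0 := by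
  have ha0 : 0 < ((unitModulusChar (LocalRing L v) ϖ : ℝ≥0) : ℝ) := NNReal.coe_pos.2 distribHaarChar_pos
  have ha1 : ((unitModulusChar (LocalRing L v) ϖ : ℝ≥0) : ℝ) < 1 := by exact_mod_cast K2E3SphericalCFunctionShellExpansion.unitModulusChar_uniformizer_lt_one L v hns ϖ hϖ
  have hz : ‖((χ₁ ϖ : ℂˣ) : ℂ)‖ < 1 := by rw [hχ₁ ϖ]; exact Real.rpow_lt_one ha0.le ha1 hs
  have hreg := K2E3NonUnitaryCharacterDichotomy.cmTorusCharPair_ne_weyl_of_exists_norm_ne_one L v hns χ₁ χ₂ h₁ ⟨ϖ, hz.ne⟩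
  -- the intertwining integral and its Macdonald value on `f_K`
  obtain ⟨J, -, -, hJK⟩ := exists_intertwiningIntegral_sphericalVector_eq_macdonald_smul L v hns w hunrL χ₁ χ₂ h₁ h₂ hχ₂ hunr hs hχ₁
    ϖ hϖ w₀ hw₀ μ fK hfK fK' hfK' hK'1
  have hq1 : (1 : ℝ) ≤ ((Ideal.absNorm v.asIdeal : ℕ) : ℝ) := by exact_mod_cast Nat.one_le_iff_ne_zero.2 fun h => v.ne_bot (Ideal.absNorm_eq_zero_iff.1 h)
  have hq0 : ((Ideal.absNorm v.asIdeal : ℕ) : ℂ) ≠ 0 := by exact_mod_cast fun h => v.ne_bot (Ideal.absNorm_eq_zero_iff.1 h)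
  have hnq : ‖((Ideal.absNorm v.asIdeal : ℕ) : ℂ)‖ = ((Ideal.absNorm v.asIdeal : ℕ) : ℝ) := by rw [Complex.norm_natCast]
  -- `|z∕q| < 1`, `|z∕q²| < 1`, `|z²| < 1`, `|z| < 1` ⇒ the Macdonald factors are units
  have hsmall : ∀ t : ℂ, ‖t‖ < 1 → (1 + t ≠ 0 ∧ 1 - t ≠ 0) := fun t ht =>
    ⟨fun h => by rw [add_eq_zero_iff_eq_neg] at h; rw [← neg_neg t, ← h, norm_neg, norm_one] at ht; exact lt_irrefl _ ht,
     fun h => by rw [sub_eq_zero] at h; rw [← h, norm_one] at ht; exact lt_irrefl _ ht⟩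
  have hzq : ‖((χ₁ ϖ : ℂˣ) : ℂ) / ((Ideal.absNorm v.asIdeal : ℕ) : ℂ)‖ < 1 := by
    rw [norm_div, hnq]; exact (div_le_self (norm_nonneg _) hq1).trans_lt hz
  have hzq2 : ‖((χ₁ ϖ : ℂˣ) : ℂ) / ((Ideal.absNorm v.asIdeal : ℕ) : ℂ) ^ 2‖ < 1 := by
    rw [norm_div, norm_pow, hnq]; exact (div_le_self (norm_nonneg _) (one_le_pow₀ hq1)).trans_lt hz
  have hz2 : ‖((χ₁ ϖ : ℂˣ) : ℂ) ^ 2‖ < 1 := by rw [norm_pow]; exact pow_lt_one₀ (norm_nonneg _) hz two_ne_zero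
  have hM : (μ.real {u : ↥(cmBorelTriple L 3 v).N | (((∏ w' : PlacesOver L v, normAbs (w'.1.adicCompletion L) ((((((u : ↥(unitaryGroupOfForm (conjLocal L (IsCMField.complexConj L) v) (cmLocalForm L 3 v)))) : GL (Fin 3) (LocalRing L v)) : Matrix (Fin 3) (Fin 3) (LocalRing L v)) 0 2) w')) : ℝ≥0) : ℝ) ≤ 1} : ℂ) ≠ 0 := by exact_mod_cast (K2E3SphericalReducibilityJunction.measureReal_heightBall_one_pos L v hns ϖ hϖ μ).ne'
  have hc0 : (J fK).toFun 1 ≠ 0 := by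
    rw [hJK, Representation.SmoothInd.toFun_smul, Pi.smul_apply, hK'1, hK1, smul_eq_mul, mul_one, mul_one]
    exact mul_ne_zero hM (mul_ne_zero (mul_ne_zero (hsmall _ hzq).1 (hsmall _ hzq2).2) (inv_ne_zero (hsmall _ hz2).2))
  rw [K2E3SphericalReducibilityJunction.reducible_iff_forall_eval_mul_eval_eq_zero L v hns χ₁ χ₂ h₁ h₂ hreg fK hfK hK1 fK' hfK' hK'1]
  exact ⟨fun h B => (mul_eq_zero.1 (h J B)).resolve_left hc0, fun h A B => by rw [h B, mul_zero]⟩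

end Summit.HodgeConjecture.HodgeConjecture.Cruxes.H413.K2E3SphericalCFunctionMacdonaldInertDyadic

end
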